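import Literature.Geometry.Lorentzian.ADMTailClassPointwise
import Literature.Geometry.Lorentzian.QuasiFinalAnalytic
import Mathlib.Analysis.InnerProductSpace.Dual
import Mathlib.Topology.Algebra.Module.FiniteDimension
import Mathlib.LinearAlgebra.Dual.Lemmas
import Mathlib.Analysis.SpecialFunctions.Pow.Asymptotics
import HarnessLib

/-!
# Late label lines of the tail class are uniformly timelike far out (Ellithy 2026, §3.1 / Def. 3.6 / Def. 4.4)

A. Ellithy, *The spacetime Penrose inequality under a quasi final state hypothesis*,
arXiv:2605.18730 (2026), §3.1 (general ADM form, p. 21), Definition 3.6 (p. 21), Definition 4.4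
(p. 39).

In the general ADM form `g = -(N² - |β|²_{g(t)}) dt² + 2 β ⊙ dt + g(t)` (§3.1, p. 21) the label
lines `t ↦ (t, r, p)` of the chart have `g(∂_t, ∂_t) = -(N² - |β|²_{g(t)})`
(`ADMTailTuple.admForm_apply_dt_dt`).  For a tuple of the class `𝒞𝒮_{-τ}(ℳ)` (Def. 3.6), `N ≥ ϑ_* > 0`
on every fixed tail (Def. 3.6 (ii)) while `β = O(r^{-τ})`, `λ ≥ δ_*`, `b = O(r^{-τ})`,
`r⁻²γ - γ_{S²} = O(r^{-τ})` (Def. 3.6 (i)(ii), pointwise: `ADMTailClassPointwise`), so `g(t)` is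
uniformly equivalent to the Euclidean metric of the Cartesian slice coordinates far out and
`|β|²_{g(t)} = O(r^{-2τ})`.  Hence — this module's theorem —

* `ADMTailTuple.IsTailCoeff.admForm_dt_dt_le` : for `𝒮 ∈ 𝒞𝒮_{-τ}(ℳ_{T̲,r₀})`, `r₀ ≥ 0`, `τ > 0`,
  there are `R > r₀` and `c₀ > 0` with `g(∂_t, ∂_t) = admForm 𝒮 (t, y) (∂_t, ∂_t) ≤ -c₀` for all
  `t > T̲`, `|y| ≥ R`: ALL late label lines beyond `r = R` are uniformly timelike;
* `HasADMForm.label_timelike`, `IsQuasiFinalAnalytic.label_timelike` : the same for the late chart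
  `Φ` of Def. 4.4 (1): `g(dΦ ∂_t, dΦ ∂_t) ≤ -c₀` on `{t > T̲} × {|y| ≥ R}`.

The proof is the elementary linear algebra the print leaves implicit: a bilinear form `B` on `E3`
with `B(X, X) ≥ m |X|²`, `m > 0`, is invertible (finite dimension) with
`0 ≤ ω(B⁻¹ω) ≤ |ω|²/m` (`§1`); the radial completion `γ̂` and the slice metric `g(t)` of the tuple
are such forms far out (`§3`, `§4`, from the pointwise decay), whence `|b|²_γ ≥ 0` and
`|β|²_{g(t)} ≤ |β|²_{eucl}/m = O(r^{-2τ})` (`§5`).  No facts; nothing here is specific to any summit.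

## References

* [Ellithy2026] A. Ellithy, arXiv:2605.18730 (2026), §3.1 (p. 21), Def. 3.6 (p. 21), Def. 4.4
  (p. 39).
-/

noncomputable section

set_option maxSynthPendingDepth 3

open Set Metric Function Filter
open scoped ENNReal NNReal Topology RealInnerProductSpace Manifold

namespace Literature.Geometry.Lorentzian

/-! ### §1 Coercive bilinear forms on `E3`: invertibility and `0 ≤ ω(B⁻¹ω) ≤ |ω|²/m` -/

section Coercive

variable {B : E3 →L[ℝ] E3 →L[ℝ] ℝ} {m : ℝ}

/-- A coercive form `B(X,X) ≥ m|X|²`, `m > 0`, is injective as a map `E3 → E3*`. [folklore] -/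
private theorem injective_of_coercive (hm : 0 < m) (hB : ∀ X : E3, m * ‖X‖ ^ 2 ≤ B X X) :
    Function.Injective B := by
  intro X Y hXY
  have h0 : B (X - Y) (X - Y) = 0 := by
    have : B (X - Y) = 0 := by rw [map_sub, hXY, sub_self]
    rw [this, zero_apply]
  have h1 : m * ‖X - Y‖ ^ 2 ≤ 0 := h0 ▸ hB (X - Y)
  have h2 : ‖X - Y‖ ^ 2 ≤ 0 := by
    by_contra hc
    exact absurd h1 (not_le.mpr (mul_pos hm (lt_of_not_ge hc)))
  have h3 : ‖X - Y‖ = 0 := by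
    have := le_antisymm h2 (sq_nonneg _)
    exact pow_eq_zero_iff (n := 2) two_ne_zero |>.mp this
  exact sub_eq_zero.mp (norm_eq_zero.mp h3)

/-- A coercive form on `E3` is a continuous linear isomorphism `E3 ≃ E3*` (finite dimension:
injective and `dim E3 = dim E3*`). [folklore] -/
private theorem exists_equiv_of_coercive (hm : 0 < m) (hB : ∀ X : E3, m * ‖X‖ ^ 2 ≤ B X X) :
    ∃ e : E3 ≃L[ℝ] (E3 →L[ℝ] ℝ), (e : E3 →L[ℝ] E3 →L[ℝ] ℝ) = B := by
  have hinj := injective_of_coercive hm hB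
  have hfin : Module.finrank ℝ E3 = Module.finrank ℝ (E3 →L[ℝ] ℝ) := by
    have h1 : Module.finrank ℝ (E3 →L[ℝ] ℝ) = Module.finrank ℝ (E3 →ₗ[ℝ] ℝ) :=
      (LinearEquiv.finrank_eq
        (LinearMap.toContinuousLinearMap : (E3 →ₗ[ℝ] ℝ) ≃ₗ[ℝ] (E3 →L[ℝ] ℝ))).symm
    rw [h1]; exact Subspace.dual_finrank_eq.symm
  have hsurj : Function.Surjective B :=
    (LinearMap.injective_iff_surjective_of_finrank_eq_finrank hfin
      (f := (B : E3 →ₗ[ℝ] E3 →L[ℝ] ℝ))).mp hinj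
  exact ⟨ContinuousLinearEquiv.ofBijective B (LinearMap.ker_eq_bot.mpr hinj)
    (LinearMap.range_eq_top.mpr hsurj), ContinuousLinearEquiv.coe_ofBijective _ _ _⟩

/-- **`0 ≤ ω(B⁻¹ω) ≤ |ω|²/m` and `B(B⁻¹ω) = ω`** for a coercive form `B(X,X) ≥ m|X|²`, `m > 0`
(`B⁻¹ = ContinuousLinearMap.inverse B`, the true inverse here). [folklore] -/
private theorem apply_inverse_of_coercive (hm : 0 < m) (hB : ∀ X : E3, m * ‖X‖ ^ 2 ≤ B X X)
    (ω : E3 →L[ℝ] ℝ) :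
    B (B.inverse ω) = ω ∧ 0 ≤ ω (B.inverse ω) ∧ ω (B.inverse ω) ≤ ‖ω‖ ^ 2 / m := by
  obtain ⟨e, he⟩ := exists_equiv_of_coercive hm hB
  have hinv : B.inverse = (e.symm : (E3 →L[ℝ] ℝ) →L[ℝ] E3) := by
    rw [← he]; exact ContinuousLinearMap.inverse_equiv e
  set X := B.inverse ω with hX
  have hBX : B X = ω := by
    rw [hX, hinv, ← he]
    exact e.apply_symm_apply ω
  have hωX : ω X = B X X := by rw [hBX]
  have hlow : m * ‖X‖ ^ 2 ≤ ω X := hωX ▸ hB X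
  have hnonneg : 0 ≤ ω X := le_trans (mul_nonneg hm.le (sq_nonneg _)) hlow
  refine ⟨hBX, hnonneg, ?_⟩
  have hup : ω X ≤ ‖ω‖ * ‖X‖ := (le_abs_self _).trans (by simpa using ω.le_opNorm X)
  -- from `m |X|² ≤ ω X ≤ |ω| |X|`: `m |X| ≤ |ω|`, so `ω X ≤ |ω| |X| ≤ |ω|²/m`
  have hXle : ‖X‖ ≤ ‖ω‖ / m := by
    rw [le_div_iff₀ hm]
    by_cases h0 : ‖X‖ = 0
    · rw [h0, zero_mul]; exact norm_nonneg _
    · have hpos : 0 < ‖X‖ := lt_of_le_of_ne (norm_nonneg _) (Ne.symm h0)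
      have : m * ‖X‖ * ‖X‖ ≤ ‖ω‖ * ‖X‖ := by rw [mul_assoc, ← sq]; exact hlow.trans hup
      rw [mul_comm ‖X‖ m]
      exact le_of_mul_le_mul_right this hpos
  calc ω X ≤ ‖ω‖ * ‖X‖ := hup
    _ ≤ ‖ω‖ * (‖ω‖ / m) := mul_le_mul_of_nonneg_left hXle (norm_nonneg _)
    _ = ‖ω‖ ^ 2 / m := by rw [sq, mul_div_assoc]

end Coercive

/-! ### §2 The projection `Π_p` and Pythagoras on `E3 = ℝp ⊕ p^⊥` -/

section Proj

/-- `Π_p X = X - ⟪p, X⟫ p`. [folklore] -/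
private theorem proj_apply (p X : E3) : sphereTanProj p X = X - ⟪p, X⟫ • p := by
  simp [sphereTanProj, ContinuousLinearMap.smulRight_apply, innerSL_apply_apply]

/-- **Pythagoras**: `|X|² = ⟪p, X⟫² + |Π_p X|²` for a unit vector `p`. [folklore] -/
private theorem norm_sq_eq_inner_sq_add_proj (p : sphere (0 : E3) 1) (X : E3) :
    ‖X‖ ^ 2 = ⟪(p : E3), X⟫ ^ 2 + ‖sphereTanProj (p : E3) X‖ ^ 2 := by
  have hp : ‖(p : E3)‖ = 1 := by simp
  rw [proj_apply, norm_sub_sq_real, norm_smul, hp, mul_one, Real.norm_eq_abs, sq_abs, inner_smul_right,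
    real_inner_comm]
  ring

/-- `|Π_p X| ≤ |X|`. [folklore] -/
private theorem norm_proj_le (p : sphere (0 : E3) 1) (X : E3) : ‖sphereTanProj (p : E3) X‖ ≤ ‖X‖ := by
  have h := norm_sq_eq_inner_sq_add_proj p X
  nlinarith [sq_nonneg ⟪(p : E3), X⟫, norm_nonneg (sphereTanProj (p : E3) X), norm_nonneg X]

/-- `|⟪p, X⟫| ≤ |X|`. [folklore] -/
private theorem abs_inner_le_norm' (p : sphere (0 : E3) 1) (X : E3) : |⟪(p : E3), X⟫| ≤ ‖X‖ := by
  have hp : ‖(p : E3)‖ = 1 := by simp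
  simpa [hp] using abs_real_inner_le_norm (p : E3) X

/-- `‖Π_p‖ ≤ 1` (operator norm). [folklore] -/
private theorem opNorm_proj_le (p : sphere (0 : E3) 1) : ‖sphereTanProj (p : E3)‖ ≤ 1 :=
  ContinuousLinearMap.opNorm_le_bound _ zero_le_one fun X ↦ by
    rw [one_mul]; exact norm_proj_le p X

/-- `Π_p` is idempotent for a unit vector. [folklore] -/
private theorem proj_idem (p : sphere (0 : E3) 1) (X : E3) :
    sphereTanProj (p : E3) (sphereTanProj (p : E3) X) = sphereTanProj (p : E3) X := by
  have hp : ‖(p : E3)‖ = 1 := by simp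
  have h0 : ⟪(p : E3), sphereTanProj (p : E3) X⟫ = 0 := by
    rw [proj_apply, inner_sub_right, inner_smul_right, real_inner_self_eq_norm_sq, hp, one_pow, mul_one,
      sub_self]
  conv_lhs => rw [proj_apply]
  rw [h0, zero_smul, sub_zero]

/-- The angular velocity map is `|y|⁻¹ Π`, so `‖angVel y‖ ≤ |y|⁻¹`. [folklore] -/
private theorem opNorm_angVel_le (y : E3) : ‖ADMTailTuple.angVel y‖ ≤ ‖y‖⁻¹ := by
  unfold ADMTailTuple.angVel
  refine (norm_smul_le _ _).trans ?_
  rw [norm_inv, norm_norm]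
  exact mul_le_of_le_one_right (inv_nonneg.mpr (norm_nonneg _)) (opNorm_proj_le _)

end Proj

/-! ### §3 The radial completion `γ̂` is coercive far out; `|ω|²_γ ≥ 0` there -/

namespace ADMTailTuple

section GammaHat

variable (S : ADMTailTuple) (t r : ℝ) (p : sphere (0 : E3) 1)

/-- `γ_tan(X, Y) = γ(Π X, Π Y)`. [cite: Ellithy2026, §3.1 p. 21] -/
theorem gammaTan_apply (X Y : E3) :
    S.gammaTan t r p X Y = S.γ t r p (sphereTanProj (p : E3) X) (sphereTanProj (p : E3) Y) := by
  simp [gammaTan]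

/-- `(r⁻²γ - γ_{S²})(X, Y) = r⁻² γ_tan(X, Y) - ⟪Π X, Π Y⟫`. [cite: Ellithy2026, Def. 3.6 p. 21] -/
theorem gammaDev_apply (X Y : E3) :
    S.gammaDev t r p X Y = (r ^ 2)⁻¹ * S.gammaTan t r p X Y -
      ⟪sphereTanProj (p : E3) X, sphereTanProj (p : E3) Y⟫ := by
  simp [gammaDev, gammaTan, inner_sub_left, inner_sub_right, real_inner_smul_right, real_inner_comm]
  ring

/-- `γ̂(X, Y) = γ_tan(X, Y) + ⟪p, X⟫ ⟪p, Y⟫` (the radial completion used to invert `γ` on tangential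
tensors, `ADMTailCoefficientClass`). [cite: Ellithy2026, §3.1 p. 21] -/
theorem gammaHat_apply (X Y : E3) :
    S.gammaHat t r p X Y = S.gammaTan t r p X Y + ⟪(p : E3), X⟫ * ⟪(p : E3), Y⟫ := by
  simp [gammaHat]

variable {S t r p}

/-- `γ_tan(X, X) = r² (|Π X|² + (r⁻²γ - γ_{S²})(Π X, Π X))` for `r ≠ 0`: the deviation form sees only
the tangential part. [cite: Ellithy2026, Def. 3.6 p. 21] -/
theorem gammaTan_self_eq (hr : r ≠ 0) (X : E3) :
    S.gammaTan t r p X X = r ^ 2 * (‖sphereTanProj (p : E3) X‖ ^ 2 +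
      S.gammaDev t r p (sphereTanProj (p : E3) X) (sphereTanProj (p : E3) X)) := by
  have hr2 : r ^ 2 ≠ 0 := pow_ne_zero 2 hr
  rw [gammaDev_apply, gammaTan_apply, gammaTan_apply, proj_idem, real_inner_self_eq_norm_sq]
  field_simp
  ring

/-- `γ_tan(X, X) ≥ r² (1 - ‖r⁻²γ - γ_{S²}‖) |Π X|²` (`r ≠ 0`). [cite: Ellithy2026, Def. 3.6 p. 21] -/
theorem gammaTan_self_ge (hr : r ≠ 0) (X : E3) :
    r ^ 2 * (1 - ‖S.gammaDev t r p‖) * ‖sphereTanProj (p : E3) X‖ ^ 2 ≤ S.gammaTan t r p X X := by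
  rw [gammaTan_self_eq hr]
  have h := ContinuousLinearMap.le_opNorm₂ (S.gammaDev t r p) (sphereTanProj (p : E3) X)
    (sphereTanProj (p : E3) X)
  rw [Real.norm_eq_abs] at h
  have h' := neg_le_of_abs_le h
  have hr2 : 0 ≤ r ^ 2 := sq_nonneg r
  nlinarith [hr2, norm_nonneg (sphereTanProj (p : E3) X)]

/-- **`γ̂` is coercive far out**: if `r ≥ 1` and `‖r⁻²γ - γ_{S²}‖ ≤ 1/2` at `(t, r, p)` then
`γ̂(X, X) ≥ ½ |X|²`. [cite: Ellithy2026, Def. 3.6 p. 21] -/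
theorem gammaHat_coercive (hr : 1 ≤ r) (hd : ‖S.gammaDev t r p‖ ≤ 1 / 2) (X : E3) :
    (1 / 2 : ℝ) * ‖X‖ ^ 2 ≤ S.gammaHat t r p X X := by
  have hr0 : r ≠ 0 := by positivity
  rw [gammaHat_apply, norm_sq_eq_inner_sq_add_proj p X, ← sq]
  have h1 := gammaTan_self_ge (S := S) (t := t) (p := p) hr0 X
  have hq : 0 ≤ ‖sphereTanProj (p : E3) X‖ ^ 2 := sq_nonneg _
  have hr2 : 1 ≤ r ^ 2 := by nlinarith
  have h2 : (1 / 2 : ℝ) * ‖sphereTanProj (p : E3) X‖ ^ 2 ≤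
      r ^ 2 * (1 - ‖S.gammaDev t r p‖) * ‖sphereTanProj (p : E3) X‖ ^ 2 := by
    apply mul_le_mul_of_nonneg_right _ hq
    nlinarith [norm_nonneg (S.gammaDev t r p)]
  nlinarith [sq_nonneg ⟪(p : E3), X⟫]

/-- **`|ω|²_γ ≥ 0` far out** (where `γ̂` is coercive, `γ̂⁻¹` is the true inverse and
`|ω|²_γ = ω'(γ̂⁻¹ ω') ≥ 0`, `ω' = ω ∘ Π`). [cite: Ellithy2026, §3.1 p. 21] -/
theorem gammaNormSq_nonneg (hr : 1 ≤ r) (hd : ‖S.gammaDev t r p‖ ≤ 1 / 2) (ω : E3 →L[ℝ] ℝ) :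
    0 ≤ S.gammaNormSq t r p ω := by
  have hco := gammaHat_coercive (S := S) (t := t) (p := p) hr hd
  obtain ⟨-, hnn, -⟩ := apply_inverse_of_coercive (by norm_num : (0 : ℝ) < 1 / 2) hco
    (ω.comp (sphereTanProj (p : E3)))
  simpa [gammaNormSq, gammaSharp] using hnn

end GammaHat

/-! ### §4 The slice metric `g(t)` is coercive far out -/

section SliceMetric

variable {S : ADMTailTuple} {t : ℝ} {y : E3}

/-- `angVel y X = |y|⁻¹ Π X`. [folklore] -/
private theorem angVel_apply (y X : E3) : angVel y X = ‖y‖⁻¹ • sphereTanProj (raySphere y : E3) X := rfl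

/-- **`g(t)(X, X)` expanded** (§3.1, p. 21: `g(t) = (λ² + |b|²_γ) dr² + 2 b ⊙ dr + γ` at `y = r p`):
`(λ² + |b|²_γ) c² + 2 c b(A X) + γ(A X, A X)`, `c = ⟪p, X⟫`, `A X = r⁻¹ Π X`. [cite: Ellithy2026, §3.1 p. 21] -/
theorem gCart_apply_self (S : ADMTailTuple) (t : ℝ) (y X : E3) :
    S.gCart t y X X = (S.lam t ‖y‖ (raySphere y) ^ 2 + S.gammaNormSq t ‖y‖ (raySphere y)
        (S.b t ‖y‖ (raySphere y))) * ⟪(raySphere y : E3), X⟫ ^ 2 +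
      2 * ⟪(raySphere y : E3), X⟫ * S.b t ‖y‖ (raySphere y) (angVel y X) +
      S.γ t ‖y‖ (raySphere y) (angVel y X) (angVel y X) := by
  simp [gCart]
  ring

/-- `γ(A X, A X) = r⁻² γ_tan(X, X)` (`A X = r⁻¹ Π X`). [cite: Ellithy2026, §3.1 p. 21] -/
theorem gamma_angVel_self (S : ADMTailTuple) (t : ℝ) (y X : E3) :
    S.γ t ‖y‖ (raySphere y) (angVel y X) (angVel y X) =
      ‖y‖⁻¹ * ‖y‖⁻¹ * S.gammaTan t ‖y‖ (raySphere y) X X := by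
  simp only [angVel_apply, map_smul, smul_apply, smul_eq_mul, gammaTan_apply]
  ring

/-- **`g(t)` is coercive far out**: at a point `y`, `|y| ≥ 1`, where `λ ≥ δ_* > 0`, `|b|²_γ ≥ 0`,
`‖r⁻²γ - γ_{S²}‖ ≤ 1/2` and `‖b‖ ≤ min(δ_*², 1/2)/4`, one has `g(t)(X, X) ≥ (min(δ_*², 1/2)/4) |X|²`.
[cite: Ellithy2026, Def. 3.6 p. 21] -/
theorem gCart_coercive {δ : ℝ} (hy : 1 ≤ ‖y‖) (hδ : 0 < δ) (hlam : δ ≤ S.lam t ‖y‖ (raySphere y))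
    (hnb : 0 ≤ S.gammaNormSq t ‖y‖ (raySphere y) (S.b t ‖y‖ (raySphere y)))
    (hd : ‖S.gammaDev t ‖y‖ (raySphere y)‖ ≤ 1 / 2)
    (hb : ‖S.b t ‖y‖ (raySphere y)‖ ≤ min (δ ^ 2) (1 / 2) / 4) (X : E3) :
    min (δ ^ 2) (1 / 2) / 4 * ‖X‖ ^ 2 ≤ S.gCart t y X X := by
  set r := ‖y‖ with hr_def
  set p := raySphere y with hp_def
  set c := ⟪(p : E3), X⟫ with hc
  set q := ‖sphereTanProj (p : E3) X‖ with hq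
  set m₁ := min (δ ^ 2) (1 / 2) with hm₁
  have hr0 : r ≠ 0 := by positivity
  have hrinv : r⁻¹ ≤ 1 := inv_le_one_of_one_le₀ hy
  have hrinv0 : 0 ≤ r⁻¹ := inv_nonneg.mpr (norm_nonneg _)
  have hX : ‖X‖ ^ 2 = c ^ 2 + q ^ 2 := norm_sq_eq_inner_sq_add_proj p X
  have hm₁δ : m₁ ≤ δ ^ 2 := min_le_left _ _
  have hm₁h : m₁ ≤ 1 / 2 := min_le_right _ _
  have hm₁0 : 0 < m₁ := lt_min (pow_pos hδ 2) (by norm_num)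
  -- term 1
  have hlam2 : δ ^ 2 ≤ S.lam t r p ^ 2 := pow_le_pow_left₀ hδ.le hlam 2
  have h1 : δ ^ 2 * c ^ 2 ≤ (S.lam t r p ^ 2 + S.gammaNormSq t r p (S.b t r p)) * c ^ 2 :=
    mul_le_mul_of_nonneg_right (by linarith) (sq_nonneg _)
  -- term 3
  have h3 : (1 / 2 : ℝ) * q ^ 2 ≤ S.γ t r p (angVel y X) (angVel y X) := by
    rw [hr_def, hp_def, gamma_angVel_self, ← hr_def, ← hp_def]
    have hg := gammaTan_self_ge (S := S) (t := t) (p := p) hr0 X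
    rw [← hq] at hg
    have hq0 : 0 ≤ q ^ 2 := sq_nonneg _
    have : (1 / 2 : ℝ) * q ^ 2 ≤ (1 - ‖S.gammaDev t r p‖) * q ^ 2 :=
      mul_le_mul_of_nonneg_right (by linarith) hq0
    calc (1 / 2 : ℝ) * q ^ 2 ≤ (1 - ‖S.gammaDev t r p‖) * q ^ 2 := this
      _ = r⁻¹ * r⁻¹ * (r ^ 2 * (1 - ‖S.gammaDev t r p‖) * q ^ 2) := by field_simp
      _ ≤ r⁻¹ * r⁻¹ * S.gammaTan t r p X X :=
          mul_le_mul_of_nonneg_left hg (mul_nonneg hrinv0 hrinv0)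
  -- term 2
  have h2 : -(m₁ / 4 * (c ^ 2 + q ^ 2)) ≤ 2 * c * S.b t r p (angVel y X) := by
    have hbA : |S.b t r p (angVel y X)| ≤ ‖S.b t r p‖ * q := by
      have h := (S.b t r p).le_opNorm (angVel y X)
      rw [Real.norm_eq_abs] at h
      refine h.trans (mul_le_mul_of_nonneg_left ?_ (norm_nonneg _))
      rw [angVel_apply, norm_smul, norm_inv, norm_norm, ← hp_def, ← hq]
      exact (mul_le_of_le_one_left (norm_nonneg _) hrinv)
    have hcq : 2 * |c| * q ≤ c ^ 2 + q ^ 2 := by nlinarith [sq_nonneg (|c| - q), sq_abs c]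
    have hb0 : 0 ≤ ‖S.b t r p‖ := norm_nonneg _
    have : |2 * c * S.b t r p (angVel y X)| ≤ m₁ / 4 * (c ^ 2 + q ^ 2) := by
      rw [abs_mul, abs_mul, abs_two]
      calc 2 * |c| * |S.b t r p (angVel y X)| ≤ 2 * |c| * (‖S.b t r p‖ * q) :=
            mul_le_mul_of_nonneg_left hbA (by positivity)
        _ = ‖S.b t r p‖ * (2 * |c| * q) := by ring
        _ ≤ ‖S.b t r p‖ * (c ^ 2 + q ^ 2) := mul_le_mul_of_nonneg_left hcq hb0
        _ ≤ m₁ / 4 * (c ^ 2 + q ^ 2) := mul_le_mul_of_nonneg_right hb (by positivity)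
    exact neg_le_of_abs_le this
  rw [gCart_apply_self, hX, ← hr_def, ← hp_def, ← hc]
  nlinarith [sq_nonneg c, sq_nonneg q, h1, h2, h3, hm₁δ, hm₁h, hm₁0]

/-- **`|β|²_{euclidean}` bound**: `‖βCart‖ ≤ |β_r| + ‖β^T‖` at `|y| ≥ 1`. [cite: Ellithy2026, §3.1 p. 21] -/
theorem norm_βCart_le (S : ADMTailTuple) (t : ℝ) {y : E3} (hy : 1 ≤ ‖y‖) :
    ‖S.βCart t y‖ ≤ |S.βr t ‖y‖ (raySphere y)| + ‖S.βT t ‖y‖ (raySphere y)‖ := by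
  have hp : ‖(raySphere y : E3)‖ = 1 := by simp
  unfold βCart
  refine (norm_add_le _ _).trans (add_le_add ?_ ?_)
  · rw [norm_smul, Real.norm_eq_abs, innerSL_apply_norm, hp, mul_one]
  · refine (ContinuousLinearMap.opNorm_comp_le _ _).trans ?_
    refine mul_le_of_le_one_right (norm_nonneg _) ?_
    exact (opNorm_angVel_le y).trans (inv_le_one_of_one_le₀ hy)

/-- **`|β|²_{g(t)} ≤ ‖βCart‖² / m`** where `g(t)` is `m`-coercive (`g(t)⁻¹` is then the true inverse).
[cite: Ellithy2026, §3.1 p. 21] -/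
theorem betaNormSq_le {m : ℝ} (hm : 0 < m) (hco : ∀ X : E3, m * ‖X‖ ^ 2 ≤ S.gCart t y X X) :
    S.betaNormSq t y ≤ ‖S.βCart t y‖ ^ 2 / m :=
  (apply_inverse_of_coercive hm hco (S.βCart t y)).2.2

end SliceMetric

/-! ### §5 Far label lines are uniformly timelike -/

section LabelLines

variable {S : ADMTailTuple} {α τ Tlo r₀ : ℝ}

/-- **Late label lines of a tuple of the class `𝒞𝒮_{-τ}(ℳ)` are uniformly timelike far out**
(Ellithy 2026: ADM form §3.1 p. 21, class Def. 3.6 p. 21): for `𝒮 ∈ 𝒞𝒮_{-τ}(ℳ_{T̲, r₀})`, `r₀ ≥ 0`,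
`τ > 0`, there are `R > r₀` and `c₀ > 0` such that `g(∂_t, ∂_t) = admForm 𝒮 (t, y) (∂_t, ∂_t) ≤ -c₀`
for every `t > T̲` and every `|y| ≥ R`. [cite: Ellithy2026, Def. 3.6 p. 21] -/
theorem IsTailCoeff.admForm_dt_dt_le (h : S.IsTailCoeff α τ Tlo r₀) (hr₀ : 0 ≤ r₀) (hτ : 0 < τ) :
    ∃ R c₀ : ℝ, r₀ < R ∧ 0 < c₀ ∧ ∀ (t : ℝ) (y : E3), Tlo < t → R ≤ ‖y‖ →
      S.admForm t y ((1 : ℝ), (0 : E3)) ((1 : ℝ), (0 : E3)) ≤ -c₀ := by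
  -- constants of the class on the tail `r > r₁ := r₀ + 1`
  have hr₁ : r₀ < r₀ + 1 := by linarith
  obtain ⟨ϑ, hϑ, hN⟩ := (h.tail hr₁).2.1.lapse_bounds
  obtain ⟨δ, hδ, hlam⟩ := (h.tail hr₁).2.1.lam_bounds
  obtain ⟨C, hC0, hdec⟩ := h.pointwise_decay hr₀ hr₁
  set m₁ := min (δ ^ 2) (1 / 2) with hm₁
  have hm₁0 : 0 < m₁ := lt_min (pow_pos hδ 2) (by norm_num)
  set m := m₁ / 4 with hm
  have hm0 : 0 < m := by positivity
  -- far out, `C r^{-τ}` is below every threshold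
  have hlim : Tendsto (fun r : ℝ ↦ C * r ^ (-τ)) atTop (𝓝 0) := by
    simpa using (tendsto_rpow_neg_atTop hτ).const_mul C
  have hlim2 : Tendsto (fun r : ℝ ↦ (2 * (C * r ^ (-τ))) ^ 2 / m) atTop (𝓝 0) := by
    have := ((hlim.const_mul 2).pow 2).div_const m
    simpa using this
  have hev : ∀ᶠ r : ℝ in atTop, C * r ^ (-τ) ≤ 1 / 2 ∧ C * r ^ (-τ) ≤ m₁ / 4 ∧
      (2 * (C * r ^ (-τ))) ^ 2 / m ≤ ϑ ^ 2 / 2 := by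
    refine ((hlim.eventually (eventually_le_nhds (by norm_num : (0 : ℝ) < 1 / 2))).and
      ((hlim.eventually (eventually_le_nhds (by positivity : (0 : ℝ) < m₁ / 4))).and
      (hlim2.eventually (eventually_le_nhds (by positivity : (0 : ℝ) < ϑ ^ 2 / 2)))))
  obtain ⟨R₀, hR₀⟩ := eventually_atTop.mp hev
  set R := max R₀ (r₀ + 2) with hR
  refine ⟨R, ϑ ^ 2 / 2, by rw [hR]; exact lt_max_of_lt_right (by linarith), by positivity,
    fun t y ht hy ↦ ?_⟩
  -- at the point
  have hyR₀ : R₀ ≤ ‖y‖ := (le_max_left _ _).trans hy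
  have hy1 : 1 ≤ ‖y‖ := by
    have : r₀ + 2 ≤ ‖y‖ := (le_max_right _ _).trans hy
    linarith
  have hyr₁ : r₀ + 1 < ‖y‖ := by
    have : r₀ + 2 ≤ ‖y‖ := (le_max_right _ _).trans hy
    linarith
  obtain ⟨hε1, hε2, hε3⟩ := hR₀ ‖y‖ hyR₀
  set r := ‖y‖ with hr_def
  set p := raySphere y with hp_def
  obtain ⟨hNlo, -⟩ := hN t r p ht hyr₁
  obtain ⟨hlamlo, -⟩ := hlam t r p ht hyr₁
  obtain ⟨-, -, hb, hshift, hγ⟩ := hdec t r p ht hyr₁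
  obtain ⟨hβr, hβT⟩ := shift_components_le hshift
  have hd : ‖S.gammaDev t r p‖ ≤ 1 / 2 := hγ.trans hε1
  have hb' : ‖S.b t r p‖ ≤ min (δ ^ 2) (1 / 2) / 4 := hb.trans hε2
  -- `|b|²_γ ≥ 0`, `g(t)` coercive, `|β|²_{g(t)} ≤ ‖βCart‖²/m`
  have hnb : 0 ≤ S.gammaNormSq t r p (S.b t r p) := gammaNormSq_nonneg hy1 hd _
  have hco : ∀ X : E3, m * ‖X‖ ^ 2 ≤ S.gCart t y X X := by
    intro X
    have := gCart_coercive (S := S) (t := t) hy1 hδ hlamlo hnb hd hb' X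
    simpa [hm, hm₁] using this
  have hβ : ‖S.βCart t y‖ ≤ 2 * (C * r ^ (-τ)) := by
    have := norm_βCart_le S t hy1
    rw [← hr_def, ← hp_def] at this
    linarith
  have hβ0 : 0 ≤ ‖S.βCart t y‖ := norm_nonneg _
  have hbn : S.betaNormSq t y ≤ ϑ ^ 2 / 2 := by
    refine (betaNormSq_le hm0 hco).trans ?_
    calc ‖S.βCart t y‖ ^ 2 / m ≤ (2 * (C * r ^ (-τ))) ^ 2 / m := by
          apply div_le_div_of_nonneg_right _ hm0.le
          exact pow_le_pow_left₀ hβ0 hβ 2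
      _ ≤ ϑ ^ 2 / 2 := hε3
  -- conclude: `g(∂_t,∂_t) = -(N² - |β|²) ≤ -(ϑ² - ϑ²/2)`
  have hN2 : ϑ ^ 2 ≤ S.N t r p ^ 2 := pow_le_pow_left₀ hϑ.le hNlo 2
  rw [admForm_apply_dt_dt, ← hr_def, ← hp_def]
  linarith

end LabelLines

end ADMTailTuple

/-! ### §6 The late chart of Definition 4.4: `g(dΦ ∂_t, dΦ ∂_t) ≤ -c₀` far out -/

section Chart

variable {EM : Type*} [NormedAddCommGroup EM] [NormedSpace ℝ EM] {HM : Type*}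
  [TopologicalSpace HM] {I : ModelWithCorners ℝ EM HM} {M : Type*} [TopologicalSpace M]
  [ChartedSpace HM M] {g : Π x : M, TangentSpace I x →L[ℝ] TangentSpace I x →L[ℝ] ℝ}
  {Φ : ℝ × ℝ × sphere (0 : E3) 1 → M} {Tlo r₀ α τ : ℝ} {S : ADMTailTuple}

/-- **The late label lines `t ↦ Φ(t, r, p)` are uniformly timelike far out**: if `Φ^* g` has the ADM
form of a tuple `𝒮 ∈ 𝒞𝒮_{-τ}(ℳ_{T̲, r₀})` (`r₀ ≥ 0`, `τ > 0`), then there are `R > r₀`, `c₀ > 0` with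
`(Φ^* g)_{(t,y)}(∂_t, ∂_t) ≤ -c₀` for all `t > T̲`, `|y| ≥ R` (Ellithy 2026, ADM form p. 21 / Def. 4.4
(1) p. 39 with Def. 3.6 p. 21). [cite: Ellithy2026, Def. 4.4 p. 39] -/
theorem HasADMForm.label_timelike (hA : HasADMForm I g Φ Tlo r₀ S) (h : S.IsTailCoeff α τ Tlo r₀)
    (hr₀ : 0 ≤ r₀) (hτ : 0 < τ) :
    ∃ R c₀ : ℝ, r₀ < R ∧ 0 < c₀ ∧ ∀ (t : ℝ) (y : E3), Tlo < t → R ≤ ‖y‖ →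
      pullbackBilin (I := I) (I' := 𝓘(ℝ, ℝ × E3)) (polarChart Φ) g (t, y) ((1 : ℝ), (0 : E3))
        ((1 : ℝ), (0 : E3)) ≤ -c₀ := by
  obtain ⟨R, c₀, hR, hc₀, hfar⟩ := h.admForm_dt_dt_le hr₀ hτ
  refine ⟨R, c₀, hR, hc₀, fun t y ht hy ↦ ?_⟩
  rw [hA t y ht (hR.trans_le hy)]
  exact hfar t y ht hy

/-- **For a quasi-final-analytic late chart (Def. 4.4 (1)+(2), §4.1) the far label lines are
uniformly timelike**: `IsQuasiFinalAnalytic I g Φ T̲ r₀` gives `R > r₀`, `c₀ > 0` with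
`(Φ^* g)(∂_t, ∂_t) ≤ -c₀` on `{t > T̲} × {|y| ≥ R}`. [cite: Ellithy2026, Def. 4.4 p. 39] -/
theorem IsQuasiFinalAnalytic.label_timelike (h : IsQuasiFinalAnalytic I g Φ Tlo r₀) :
    ∃ R c₀ : ℝ, r₀ < R ∧ 0 < c₀ ∧ ∀ (t : ℝ) (y : E3), Tlo < t → R ≤ ‖y‖ →
      pullbackBilin (I := I) (I' := 𝓘(ℝ, ℝ × E3)) (polarChart Φ) g (t, y) ((1 : ℝ), (0 : E3))
        ((1 : ℝ), (0 : E3)) ≤ -c₀ := by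
  obtain ⟨hr₀, α, -, τ, hτ, S, hA, hS, -, -, -⟩ := h
  exact hA.label_timelike hS.isTailCoeff hr₀.le (by linarith [hτ.1])

end Chart

end Literature.Geometry.Lorentzian

end
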